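import Mathlib

set_option linter.dupNamespace false

/-!
# STUB-IDEAS k3 (gen 35) — «THE RECEPTACLE LADDER» for R205″ (B46 proper)

Crux `stmt-BirchSwinnertonDyer-27851` = `PrintCf2.SplitBadTwoLowerHalfOfFacts`; stub of record
`stub_heegnerIndexLowerAtTwo` (ACTIVE skeleton sha16 `f2bd84c029a8a938`); unit
`sidea-stub_heegnerIndexLowerAtTwo-3-g35` (planner, stub-ideation, k = 3, HOME family 3 «probe the
extremes», technique «decomposition into sub-stubs with a provable glue»).

NODE = R205″ (STUB-PLAN v6.5 §3 (xxxv), HARDEST NOW (b), K43 admissible delivery (a)): «the route's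
value-side receptacle `M(key)_v` maps `Λ₂`-linearly ONTO the norm-coherent sequences `lim_N S_m`»
— critic's why-it-might-fail: «a `2`-power index between the two carriers» (B46).

THE LADDER.  Write `A_m = U¹(L_m)` (additively), `t_m = N_{L_{m+1}/L_m}`, `σ_m` = the generator of
`Δ = Gal(L_m/F_m)`.  The three INTEGRAL `Δ`-presentations of the `θ_e`-part of the local unit tower are

* EIGEN        `lim_N S_m`,            `S_m = ker(1+σ_m) = {x : x·σx = 1}`  (projection-free, B46);
* MINUS-QUOTIENT `(lim_N A_m) / (lim_N A_m^{σ})`  (`A_m^σ = U¹(F_m)`);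
* COINVARIANT  `(lim_N A_m) / (1+σ)(lim_N A_m)`.

This file PROVES (sorry-free, for towers of modules over any commutative ring `R`; `R = ℤ` or
`R = Λ₂`):

* §0 `exists_coherent_lift` — COHERENT LIFTING: a levelwise map of towers whose KERNEL tower has
  onto transitions lifts coherent sequences (dependent choice along the tower; no topology, no
  Mittag-Leffler); `limMap_surjective`, `mem_ker_limMap_iff`.
* §1 the ladder: under (EQV) `t∘σ = σ∘t`, (INV) `σ² = 1`, (PROBE) `t_m(S_{m+1}) ⊆ D_m := (1−σ)A_m`
  (= k3-g34 `norm_normOneUnits_subset_prQuot`, CITED) and (F-ONTO) `t_m : A_{m+1}^σ ↠ A_m^σ`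
  (= Serre, Local Fields V §2 Prop. 3 (a) for the UNRAMIFIED step `F_{m+1}/F_m`, the same lemma as
  R213's `NormOntoPrincipal`, applied to the `F`-tower):
  `range_limMinus_eq`   — `(1−σ)_∞ : lim A ↠ lim S` is ONTO, i.e. MINUS-QUOTIENT `≅` EIGEN (index `2⁰`);
  `mem_ker_limMinus_iff` — its kernel is `lim A^σ` exactly;
  `range_coinvMap_eq`  — COINVARIANT `↠` EIGEN is ONTO (index `2⁰`);
  `two_smul_ker_coinvMap` — its kernel is killed by `2` (the `e_χ`-artefact of B46, LOCATED: a
  `2`-torsion KERNEL in the coinvariant model only, never an image index).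
* §2 presentation-invariance of what the consumer reads: `map_range_comp_of_surjective` (k3-g32's
  hypothesis `h = (range g).map ev` is the same for every presentation), `precomp_bijective_of_torsion_ker`
  and `dual_cyclic_iff` (`Hom_R(−, N)` and «`g` generates the dual» are the same when the kernel is
  `r`-torsion and `N` has no `r`-torsion — `r = 2`, `N = Λ₂` a domain), `ker_comp_of_injective`
  ((S-T) holds on EIGEN / MINUS-QUOTIENT, and fails on COINVARIANT by exactly the `2`-torsion kernel).

HONEST FRAMING.  Algebra only: no elliptic curve, no `p`-adic field and no `L`-value occurs in this
file; (PROBE), (F-ONTO), (EQV) are HYPOTHESES here (discharged resp. by k3-g34's proved probe, by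
Serre V §2 Prop. 3 (a), by k3-g34 `norm_map_eq_map_norm`); the semi-local-to-local step (SHAPIRO-v)
and the `Λ₂`-typing (MOD) are NOT in this file.  The stub is NOT proved, the crux is NOT proved,
BSD is NOT proved by any of this.
-/

namespace Summit.BirchSwinnertonDyer.BirchSwinnertonDyer.Cruxes.SplitBadTwoLowerHalfOfFacts.ReceptacleLadderK3G35

universe u v w

open Function

/-! ## §0 Towers of modules, inverse limits, coherent lifting -/

section Towers

variable {R : Type u} [CommRing R]
variable {A : ℕ → Type v} [∀ m, AddCommGroup (A m)] [∀ m, Module R (A m)]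
variable {B : ℕ → Type w} [∀ m, AddCommGroup (B m)] [∀ m, Module R (B m)]

/-- A NORM-COHERENT sequence of the tower `(A_m, t_m)`: `t_m x_{m+1} = x_m` (the shape of k3-g34
`CarrierSquareK3G34.IsCoherent`, additive / linear frame). -/
def IsCoherent (t : ∀ m, A (m + 1) →ₗ[R] A m) (x : ∀ m, A m) : Prop :=
  ∀ m, t m (x (m + 1)) = x m

/-- The inverse limit `lim_t A_m` as an `R`-submodule of `Π m, A m`. -/
def invLim (t : ∀ m, A (m + 1) →ₗ[R] A m) : Submodule R (∀ m, A m) where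
  carrier := {x | IsCoherent t x}
  add_mem' := by
    intro x y hx hy m
    have hx' : IsCoherent t x := hx
    have hy' : IsCoherent t y := hy
    simp only [Pi.add_apply, map_add, hx' m, hy' m]
  zero_mem' := by
    intro m
    simp
  smul_mem' := by
    intro c x hx m
    have hx' : IsCoherent t x := hx
    simp only [Pi.smul_apply, map_smul, hx' m]

theorem mem_invLim_iff (t : ∀ m, A (m + 1) →ₗ[R] A m) (x : ∀ m, A m) :
    x ∈ invLim t ↔ IsCoherent t x := Iff.rfl

theorem coherent_of_mem {t : ∀ m, A (m + 1) →ₗ[R] A m} (x : invLim t) :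
    IsCoherent t (x : ∀ m, A m) := x.2

/-- A levelwise family of maps, as one map of products. -/
def piMap (f : ∀ m, A m →ₗ[R] B m) : (∀ m, A m) →ₗ[R] (∀ m, B m) :=
  LinearMap.pi fun m => (f m).comp (LinearMap.proj m)

@[simp] theorem piMap_apply (f : ∀ m, A m →ₗ[R] B m) (x : ∀ m, A m) (m : ℕ) :
    piMap f x m = f m (x m) := rfl

theorem piMap_mem_invLim (tA : ∀ m, A (m + 1) →ₗ[R] A m) (tB : ∀ m, B (m + 1) →ₗ[R] B m)
    (f : ∀ m, A m →ₗ[R] B m) (hf : ∀ m a, f m (tA m a) = tB m (f (m + 1) a))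
    {x : ∀ m, A m} (hx : x ∈ invLim tA) : piMap f x ∈ invLim tB := by
  intro m
  have hx' : IsCoherent tA x := hx
  show tB m (f (m + 1) (x (m + 1))) = f m (x m)
  rw [← hf, hx' m]

/-- The map induced on inverse limits by a map of towers (`hf`: it commutes with the transitions). -/
def limMap (tA : ∀ m, A (m + 1) →ₗ[R] A m) (tB : ∀ m, B (m + 1) →ₗ[R] B m)
    (f : ∀ m, A m →ₗ[R] B m) (hf : ∀ m a, f m (tA m a) = tB m (f (m + 1) a)) :
    invLim tA →ₗ[R] invLim tB :=
  LinearMap.codRestrict (invLim tB) ((piMap f).domRestrict (invLim tA))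
    (fun x => piMap_mem_invLim tA tB f hf x.2)

@[simp] theorem limMap_apply (tA : ∀ m, A (m + 1) →ₗ[R] A m) (tB : ∀ m, B (m + 1) →ₗ[R] B m)
    (f : ∀ m, A m →ₗ[R] B m) (hf : ∀ m a, f m (tA m a) = tB m (f (m + 1) a))
    (x : invLim tA) (m : ℕ) :
    (limMap tA tB f hf x : ∀ m, B m) m = f m ((x : ∀ m, A m) m) := rfl

/-- **COHERENT LIFTING.**  Let `f : (A, tA) → (B, tB)` be a map of towers such that the KERNEL
tower has onto transitions (`hker`: every `c ∈ ker f_m` is `tA_m c'` for some `c' ∈ ker f_{m+1}`).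
Then every `tB`-coherent sequence lying levelwise in the image of `f` lifts to a `tA`-coherent
sequence.  Proof: dependent choice along the tower — given a lift `x_m`, take any preimage `z` of
`y_{m+1}`; then `x_m − tA z ∈ ker f_m`, lift it to `c' ∈ ker f_{m+1}`, and put `x_{m+1} := z + c'`.
No compactness, no Mittag-Leffler condition, no topology. -/
theorem exists_coherent_lift (tA : ∀ m, A (m + 1) →ₗ[R] A m) (tB : ∀ m, B (m + 1) →ₗ[R] B m)
    (f : ∀ m, A m →ₗ[R] B m) (hf : ∀ m a, f m (tA m a) = tB m (f (m + 1) a))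
    (hker : ∀ m (c : A m), f m c = 0 → ∃ c' : A (m + 1), f (m + 1) c' = 0 ∧ tA m c' = c)
    {y : ∀ m, B m} (hy : IsCoherent tB y) (hrange : ∀ m, ∃ a : A m, f m a = y m) :
    ∃ x : ∀ m, A m, IsCoherent tA x ∧ ∀ m, f m (x m) = y m := by
  classical
  have step : ∀ m (a : {a : A m // f m a = y m}),
      ∃ b : {b : A (m + 1) // f (m + 1) b = y (m + 1)}, tA m b.1 = a.1 := by
    intro m a
    obtain ⟨z, hz⟩ := hrange (m + 1)
    have hc : f m (a.1 - tA m z) = 0 := by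
      rw [map_sub, hf, hz, hy m, a.2, sub_self]
    obtain ⟨c', hc'0, hc'⟩ := hker m _ hc
    refine ⟨⟨z + c', by rw [map_add, hz, hc'0, add_zero]⟩, ?_⟩
    show tA m (z + c') = a.1
    rw [map_add, hc']
    abel
  choose stepF hstepF using step
  obtain ⟨x₀, hx₀⟩ := hrange 0
  let seq : ∀ m, {a : A m // f m a = y m} := fun m =>
    Nat.rec (motive := fun m => {a : A m // f m a = y m}) ⟨x₀, hx₀⟩ (fun m a => stepF m a) m
  refine ⟨fun m => (seq m).1, fun m => ?_, fun m => (seq m).2⟩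
  show tA m (seq (m + 1)).1 = (seq m).1
  exact hstepF m (seq m)

/-- The induced map on inverse limits is ONTO as soon as `f` is levelwise onto and the kernel tower
has onto transitions. -/
theorem limMap_surjective (tA : ∀ m, A (m + 1) →ₗ[R] A m) (tB : ∀ m, B (m + 1) →ₗ[R] B m)
    (f : ∀ m, A m →ₗ[R] B m) (hf : ∀ m a, f m (tA m a) = tB m (f (m + 1) a))
    (hker : ∀ m (c : A m), f m c = 0 → ∃ c' : A (m + 1), f (m + 1) c' = 0 ∧ tA m c' = c)
    (hsurj : ∀ m, Function.Surjective (f m)) :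
    Function.Surjective (limMap tA tB f hf) := by
  intro y
  obtain ⟨x, hx, hfx⟩ :=
    exists_coherent_lift tA tB f hf hker (coherent_of_mem y) (fun m => hsurj m ((y : ∀ m, B m) m))
  refine ⟨⟨x, hx⟩, Subtype.ext ?_⟩
  funext m
  exact hfx m

/-- More precisely: a coherent sequence lying levelwise in the image of `f` is in the image of the
limit map. -/
theorem mem_range_limMap (tA : ∀ m, A (m + 1) →ₗ[R] A m) (tB : ∀ m, B (m + 1) →ₗ[R] B m)
    (f : ∀ m, A m →ₗ[R] B m) (hf : ∀ m a, f m (tA m a) = tB m (f (m + 1) a))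
    (hker : ∀ m (c : A m), f m c = 0 → ∃ c' : A (m + 1), f (m + 1) c' = 0 ∧ tA m c' = c)
    (y : invLim tB) (hrange : ∀ m, (y : ∀ m, B m) m ∈ LinearMap.range (f m)) :
    y ∈ LinearMap.range (limMap tA tB f hf) := by
  obtain ⟨x, hx, hfx⟩ :=
    exists_coherent_lift tA tB f hf hker (coherent_of_mem y) (fun m => LinearMap.mem_range.1 (hrange m))
  refine LinearMap.mem_range.2 ⟨⟨x, hx⟩, Subtype.ext ?_⟩
  funext m
  exact hfx m

/-- The kernel of the limit map is the inverse limit of the kernel tower. -/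
theorem mem_ker_limMap_iff (tA : ∀ m, A (m + 1) →ₗ[R] A m) (tB : ∀ m, B (m + 1) →ₗ[R] B m)
    (f : ∀ m, A m →ₗ[R] B m) (hf : ∀ m a, f m (tA m a) = tB m (f (m + 1) a))
    (x : invLim tA) :
    x ∈ LinearMap.ker (limMap tA tB f hf) ↔ ∀ m, f m ((x : ∀ m, A m) m) = 0 := by
  rw [LinearMap.mem_ker]
  constructor
  · intro h m
    have := congrArg (fun z : invLim tB => (z : ∀ m, B m) m) h
    simpa using this
  · intro h
    apply Subtype.ext
    funext m
    simpa using h m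

end Towers

/-! ## §1 The receptacle ladder: eigen / minus-quotient / coinvariant presentations -/

section Ladder

variable {R : Type u} [CommRing R]
variable {A : ℕ → Type v} [∀ m, AddCommGroup (A m)] [∀ m, Module R (A m)]
variable (t : ∀ m, A (m + 1) →ₗ[R] A m) (σ : ∀ m, A m →ₗ[R] A m)

/-- `1 − σ` at level `m` (multiplicatively: `x ↦ x / σx`). -/
def minus (m : ℕ) : A m →ₗ[R] A m := LinearMap.id - σ m

/-- `1 + σ` at level `m` (multiplicatively: the `Δ`-norm `x ↦ x·σx`). -/
def plus (m : ℕ) : A m →ₗ[R] A m := LinearMap.id + σ m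

@[simp] theorem minus_apply (m : ℕ) (a : A m) : minus σ m a = a - σ m a := rfl

@[simp] theorem plus_apply (m : ℕ) (a : A m) : plus σ m a = a + σ m a := rfl

/-- `S_m = ker(1+σ)` — the ANTI-INVARIANTS (multiplicatively `{x : x·σx = 1}`; B46's projection-free
`H¹(F_m, T(key))`). -/
def anti (m : ℕ) : Submodule R (A m) := LinearMap.ker (plus σ m)

/-- `A_m^σ = ker(1−σ)` — the FIXED part (the principal units of `F_m`). -/
def fixedPart (m : ℕ) : Submodule R (A m) := LinearMap.ker (minus σ m)

/-- `D_m = (1−σ)A_m` — the PRINCIPAL QUOTIENTS. -/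
def prQuot (m : ℕ) : Submodule R (A m) := LinearMap.range (minus σ m)

theorem plus_minus (hσ2 : ∀ m a, σ m (σ m a) = a) (m : ℕ) (a : A m) :
    plus σ m (minus σ m a) = 0 := by
  simp only [plus_apply, minus_apply, map_sub, hσ2]
  abel

theorem minus_plus (hσ2 : ∀ m a, σ m (σ m a) = a) (m : ℕ) (a : A m) :
    minus σ m (plus σ m a) = 0 := by
  simp only [plus_apply, minus_apply, map_add, hσ2]
  abel

/-- `D_m ⊆ S_m`. -/
theorem prQuot_le_anti (hσ2 : ∀ m a, σ m (σ m a) = a) (m : ℕ) : prQuot σ m ≤ anti σ m := by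
  rintro _ ⟨a, rfl⟩
  exact plus_minus σ hσ2 m a

/-- On the fixed part, `2 = 1 + σ`: the source of the `2`-torsion in the coinvariant presentation. -/
theorem two_smul_eq_plus_of_fixed (m : ℕ) {c : A m} (hc : σ m c = c) :
    (2 : R) • c = plus σ m c := by
  rw [plus_apply, hc, two_smul]

theorem minus_comm (hEqv : ∀ m a, t m (σ (m + 1) a) = σ m (t m a)) (m : ℕ) (a : A (m + 1)) :
    minus σ m (t m a) = t m (minus σ (m + 1) a) := by
  simp only [minus_apply, map_sub, hEqv]

theorem plus_comm (hEqv : ∀ m a, t m (σ (m + 1) a) = σ m (t m a)) (m : ℕ) (a : A (m + 1)) :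
    plus σ m (t m a) = t m (plus σ (m + 1) a) := by
  simp only [plus_apply, map_add, hEqv]

/-- EIGEN presentation: `lim_N S_m` — the coherent sequences that are levelwise anti-invariant. -/
def limAnti : Submodule R (∀ m, A m) where
  carrier := {x | IsCoherent t x ∧ ∀ m, plus σ m (x m) = 0}
  add_mem' := by
    rintro x y ⟨hx, hx'⟩ ⟨hy, hy'⟩
    exact ⟨fun m => by simp only [Pi.add_apply, map_add, hx m, hy m],
      fun m => by simp only [Pi.add_apply, map_add, hx' m, hy' m, add_zero]⟩
  zero_mem' := ⟨fun m => by simp, fun m => by simp⟩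
  smul_mem' := by
    rintro c x ⟨hx, hx'⟩
    exact ⟨fun m => by simp only [Pi.smul_apply, map_smul, hx m],
      fun m => by simp only [Pi.smul_apply, map_smul, hx' m, smul_zero]⟩

theorem mem_limAnti_iff (x : ∀ m, A m) :
    x ∈ limAnti t σ ↔ IsCoherent t x ∧ ∀ m, plus σ m (x m) = 0 := Iff.rfl

/-- `(1−σ)_∞ : lim_N A_m → Π m, A m` (lands in `lim_N S_m`, `range_limMinus_le`). -/
def limMinus : invLim t →ₗ[R] (∀ m, A m) := (piMap (minus σ)).domRestrict (invLim t)

@[simp] theorem limMinus_apply (x : invLim t) (m : ℕ) :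
    limMinus t σ x m = (x : ∀ m, A m) m - σ m ((x : ∀ m, A m) m) := rfl

theorem range_limMinus_le (hσ2 : ∀ m a, σ m (σ m a) = a)
    (hEqv : ∀ m a, t m (σ (m + 1) a) = σ m (t m a)) :
    LinearMap.range (limMinus t σ) ≤ limAnti t σ := by
  rintro _ ⟨x, rfl⟩
  refine ⟨fun m => ?_, fun m => ?_⟩
  · show t m (limMinus t σ x (m + 1)) = limMinus t σ x m
    rw [limMinus_apply, limMinus_apply, map_sub, hEqv, coherent_of_mem x m]
  · exact plus_minus σ hσ2 m _

/-- **MINUS-QUOTIENT ↠ EIGEN (index `2⁰`).**  Under (EQV), (PROBE) and (F-ONTO), every norm-coherent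
anti-invariant sequence `s ∈ lim_N S_m` is `(1−σ)x` for a norm-coherent `x ∈ lim_N A_m`:
coherent lifting (§0) for the tower map `1−σ`, whose kernel tower `A^σ = U¹(F)` has onto transitions
by (F-ONTO), the levelwise preimages existing by (PROBE) one level up. -/
theorem limAnti_le_range_limMinus
    (hEqv : ∀ m a, t m (σ (m + 1) a) = σ m (t m a))
    (hSD : ∀ m (a : A (m + 1)), plus σ (m + 1) a = 0 → ∃ b : A m, minus σ m b = t m a)
    (hF : ∀ m (c : A m), σ m c = c → ∃ c' : A (m + 1), σ (m + 1) c' = c' ∧ t m c' = c) :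
    limAnti t σ ≤ LinearMap.range (limMinus t σ) := by
  rintro s ⟨hs, hs'⟩
  have hker : ∀ m (c : A m), minus σ m c = 0 →
      ∃ c' : A (m + 1), minus σ (m + 1) c' = 0 ∧ t m c' = c := by
    intro m c hc
    have hc' : c - σ m c = 0 := hc
    obtain ⟨c', h1, h2⟩ := hF m c (sub_eq_zero.1 hc').symm
    exact ⟨c', by rw [minus_apply, h1, sub_self], h2⟩
  have hrange : ∀ m, ∃ a : A m, minus σ m a = s m := by
    intro m
    obtain ⟨b, hb⟩ := hSD m (s (m + 1)) (hs' (m + 1))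
    exact ⟨b, hb.trans (hs m)⟩
  obtain ⟨x, hx, hmx⟩ :=
    exists_coherent_lift t t (minus σ) (fun m a => minus_comm t σ hEqv m a) hker hs hrange
  refine LinearMap.mem_range.2 ⟨⟨x, hx⟩, ?_⟩
  funext m
  exact hmx m

/-- `range (1−σ)_∞ = lim_N S_m` — MINUS-QUOTIENT `≅` EIGEN, NO INDEX. -/
theorem range_limMinus_eq (hσ2 : ∀ m a, σ m (σ m a) = a)
    (hEqv : ∀ m a, t m (σ (m + 1) a) = σ m (t m a))
    (hSD : ∀ m (a : A (m + 1)), plus σ (m + 1) a = 0 → ∃ b : A m, minus σ m b = t m a)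
    (hF : ∀ m (c : A m), σ m c = c → ∃ c' : A (m + 1), σ (m + 1) c' = c' ∧ t m c' = c) :
    LinearMap.range (limMinus t σ) = limAnti t σ :=
  le_antisymm (range_limMinus_le t σ hσ2 hEqv) (limAnti_le_range_limMinus t σ hEqv hSD hF)

/-- The kernel of `(1−σ)_∞` is `lim_N A_m^σ = lim_N U¹(F_m)` on the nose. -/
theorem mem_ker_limMinus_iff (x : invLim t) :
    x ∈ LinearMap.ker (limMinus t σ) ↔ ∀ m, σ m ((x : ∀ m, A m) m) = (x : ∀ m, A m) m := by
  rw [LinearMap.mem_ker]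
  constructor
  · intro h m
    have h' : (x : ∀ m, A m) m - σ m ((x : ∀ m, A m) m) = 0 := by
      simpa using congrFun h m
    exact (sub_eq_zero.1 h').symm
  · intro h
    funext m
    rw [limMinus_apply, h m, sub_self, Pi.zero_apply]

/-- The first isomorphism theorem form: `(lim_N A_m) ⧸ (lim_N A_m^σ) ≃ lim_N S_m`. -/
noncomputable def minusQuotEquiv (hσ2 : ∀ m a, σ m (σ m a) = a)
    (hEqv : ∀ m a, t m (σ (m + 1) a) = σ m (t m a))
    (hSD : ∀ m (a : A (m + 1)), plus σ (m + 1) a = 0 → ∃ b : A m, minus σ m b = t m a)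
    (hF : ∀ m (c : A m), σ m c = c → ∃ c' : A (m + 1), σ (m + 1) c' = c' ∧ t m c' = c) :
    (invLim t ⧸ LinearMap.ker (limMinus t σ)) ≃ₗ[R] limAnti t σ :=
  (limMinus t σ).quotKerEquivRange.trans
    (LinearEquiv.ofEq _ _ (range_limMinus_eq t σ hσ2 hEqv hSD hF))

/-- `(1+σ)_∞` on `lim_N A_m` (coherent by (EQV)). -/
def limPlus (hEqv : ∀ m a, t m (σ (m + 1) a) = σ m (t m a)) : invLim t →ₗ[R] invLim t :=
  limMap t t (plus σ) (fun m a => plus_comm t σ hEqv m a)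

/-- `(1+σ)(lim_N A_m)` — the `Δ`-norms in the limit. -/
def deltaNorms (hEqv : ∀ m a, t m (σ (m + 1) a) = σ m (t m a)) : Submodule R (invLim t) :=
  LinearMap.range (limPlus t σ hEqv)

theorem deltaNorms_le_ker (hσ2 : ∀ m a, σ m (σ m a) = a)
    (hEqv : ∀ m a, t m (σ (m + 1) a) = σ m (t m a)) :
    deltaNorms t σ hEqv ≤ LinearMap.ker (limMinus t σ) := by
  rintro _ ⟨x, rfl⟩
  rw [LinearMap.mem_ker]
  funext m
  show limMinus t σ (limPlus t σ hEqv x) m = 0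
  rw [limMinus_apply]
  show plus σ m ((x : ∀ m, A m) m) - σ m (plus σ m ((x : ∀ m, A m) m)) = 0
  have := minus_plus σ hσ2 m ((x : ∀ m, A m) m)
  rwa [minus_apply] at this

/-- COINVARIANT presentation `→` EIGEN: `(lim_N A_m) ⧸ (1+σ)(lim_N A_m) → Π m, A m` induced by
`(1−σ)_∞`. -/
def coinvMap (hσ2 : ∀ m a, σ m (σ m a) = a)
    (hEqv : ∀ m a, t m (σ (m + 1) a) = σ m (t m a)) :
    (invLim t ⧸ deltaNorms t σ hEqv) →ₗ[R] (∀ m, A m) :=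
  (deltaNorms t σ hEqv).liftQ (limMinus t σ) (deltaNorms_le_ker t σ hσ2 hEqv)

/-- **COINVARIANT ↠ EIGEN (index `2⁰`).** -/
theorem range_coinvMap_eq (hσ2 : ∀ m a, σ m (σ m a) = a)
    (hEqv : ∀ m a, t m (σ (m + 1) a) = σ m (t m a))
    (hSD : ∀ m (a : A (m + 1)), plus σ (m + 1) a = 0 → ∃ b : A m, minus σ m b = t m a)
    (hF : ∀ m (c : A m), σ m c = c → ∃ c' : A (m + 1), σ (m + 1) c' = c' ∧ t m c' = c) :
    LinearMap.range (coinvMap t σ hσ2 hEqv) = limAnti t σ := by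
  rw [coinvMap, Submodule.range_liftQ]
  exact range_limMinus_eq t σ hσ2 hEqv hSD hF

/-- **THE LOCATED `2`-TORSION.**  The kernel of COINVARIANT `↠` EIGEN is killed by `2`: it is
`lim A^σ ⧸ (1+σ) lim A`, and `2c = c + σc` for `σ`-fixed `c`.  (Its order is that of
`lim Ĥ⁰(Δ, U¹(L_m))`, at most `2` by local class field theory — not needed and not claimed here.) -/
theorem two_smul_ker_coinvMap (hσ2 : ∀ m a, σ m (σ m a) = a)
    (hEqv : ∀ m a, t m (σ (m + 1) a) = σ m (t m a))
    (k : invLim t ⧸ deltaNorms t σ hEqv) (hk : k ∈ LinearMap.ker (coinvMap t σ hσ2 hEqv)) :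
    (2 : R) • k = 0 := by
  obtain ⟨x, rfl⟩ := Submodule.Quotient.mk_surjective _ k
  rw [LinearMap.mem_ker, coinvMap, Submodule.liftQ_apply] at hk
  have hfix : ∀ m, σ m ((x : ∀ m, A m) m) = (x : ∀ m, A m) m :=
    (mem_ker_limMinus_iff t σ x).1 (LinearMap.mem_ker.2 hk)
  have h2 : (2 : R) • x = limPlus t σ hEqv x := by
    apply Subtype.ext
    funext m
    show (2 : R) • (x : ∀ m, A m) m = plus σ m ((x : ∀ m, A m) m)
    exact two_smul_eq_plus_of_fixed σ m (hfix m)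
  rw [← Submodule.Quotient.mk_smul, h2]
  exact (Submodule.Quotient.mk_eq_zero _).2 (LinearMap.mem_range.2 ⟨x, rfl⟩)

/-- **THE RECEPTACLE LADDER** (B46 made concrete).  Under (INV) (EQV) (PROBE) (F-ONTO): the
minus-quotient and the coinvariant presentations both map ONTO the eigen presentation `lim_N S_m`;
the former with kernel exactly `lim_N A_m^σ`, the latter with `2`-torsion kernel.  There is NO
`2`-power index on the image side in any integral `Δ`-presentation. -/
theorem receptacle_ladder (hσ2 : ∀ m a, σ m (σ m a) = a)
    (hEqv : ∀ m a, t m (σ (m + 1) a) = σ m (t m a))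
    (hSD : ∀ m (a : A (m + 1)), plus σ (m + 1) a = 0 → ∃ b : A m, minus σ m b = t m a)
    (hF : ∀ m (c : A m), σ m c = c → ∃ c' : A (m + 1), σ (m + 1) c' = c' ∧ t m c' = c) :
    LinearMap.range (limMinus t σ) = limAnti t σ ∧
      (∀ x : invLim t, x ∈ LinearMap.ker (limMinus t σ) ↔
        ∀ m, σ m ((x : ∀ m, A m) m) = (x : ∀ m, A m) m) ∧
      LinearMap.range (coinvMap t σ hσ2 hEqv) = limAnti t σ ∧
      (∀ k ∈ LinearMap.ker (coinvMap t σ hσ2 hEqv), (2 : R) • k = 0) :=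
  ⟨range_limMinus_eq t σ hσ2 hEqv hSD hF, fun x => mem_ker_limMinus_iff t σ x,
    range_coinvMap_eq t σ hσ2 hEqv hSD hF, fun k hk => two_smul_ker_coinvMap t σ hσ2 hEqv k hk⟩

/-! ### §1c The fourth rung: LEVELWISE coinvariants `lim_N (A_m ⧸ (1+σ)A_m)` (k2-g35's carrier)

The tree's `SemilocalUnitData₂.Coinv χ` is the coinvariant module of the LIMIT (`(lim A)/(1+σ)(lim A)`,
§1); k2-g35 P2 compares instead the limit of the LEVELWISE coinvariants `Q_m = A_m/(1+σ)A_m` with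
`lim_N S_m` and needs local class field theory (`Ĥ⁰`-transitions bijective) for `coker = 0`.  Here:
`(lim A)/(1+σ)(lim A) ↠ lim_N Q_m` by coherent lifting from (N-ONTO) (`t_m` onto — R213, the tree's
`UnramifiedQuadraticNorm.exists_mul_map_eq_of_sub_one_mem` on the `L`-tower), and `lim_N Q_m ↠ lim_N S_m`
with kernel killed by `2` FOR FREE from §1 (the composite factors `(1−σ)_∞`) — no class field theory. -/

/-- `Q_m = A_m ⧸ (1+σ)A_m`, the levelwise `Δ`-coinvariants (`χ(σ) = −1`). -/
abbrev LevelCoinv (m : ℕ) : Type v := A m ⧸ LinearMap.range (plus σ m)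

theorem range_plus_le_comap (hEqv : ∀ m a, t m (σ (m + 1) a) = σ m (t m a)) (m : ℕ) :
    LinearMap.range (plus σ (m + 1)) ≤ (LinearMap.range (plus σ m)).comap (t m) := by
  rintro _ ⟨a, rfl⟩
  exact LinearMap.mem_range.2 ⟨t m a, plus_comm t σ hEqv m a⟩

/-- The transition `Q_{m+1} → Q_m` induced by `t_m`. -/
def tQ (hEqv : ∀ m a, t m (σ (m + 1) a) = σ m (t m a)) (m : ℕ) :
    LevelCoinv σ (m + 1) →ₗ[R] LevelCoinv σ m :=
  Submodule.mapQ _ _ (t m) (range_plus_le_comap t σ hEqv m)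

theorem tQ_mk (hEqv : ∀ m a, t m (σ (m + 1) a) = σ m (t m a)) (m : ℕ) (a : A (m + 1)) :
    tQ t σ hEqv m (Submodule.Quotient.mk a) = Submodule.Quotient.mk (t m a) :=
  Submodule.mapQ_apply _ _ _ _

theorem range_plus_le_ker_minus (hσ2 : ∀ m a, σ m (σ m a) = a) (m : ℕ) :
    LinearMap.range (plus σ m) ≤ LinearMap.ker (minus σ m) := by
  rintro _ ⟨a, rfl⟩
  exact minus_plus σ hσ2 m a

/-- `δ_m = (1−σ)̄ : Q_m → A_m`. -/
def delta (hσ2 : ∀ m a, σ m (σ m a) = a) (m : ℕ) : LevelCoinv σ m →ₗ[R] A m :=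
  (LinearMap.range (plus σ m)).liftQ (minus σ m) (range_plus_le_ker_minus σ hσ2 m)

@[simp] theorem delta_mk (hσ2 : ∀ m a, σ m (σ m a) = a) (m : ℕ) (a : A m) :
    delta σ hσ2 m (Submodule.Quotient.mk a) = a - σ m a :=
  Submodule.liftQ_apply _ _ a

theorem delta_comm (hσ2 : ∀ m a, σ m (σ m a) = a)
    (hEqv : ∀ m a, t m (σ (m + 1) a) = σ m (t m a)) (m : ℕ) (q : LevelCoinv σ (m + 1)) :
    delta σ hσ2 m (tQ t σ hEqv m q) = t m (delta σ hσ2 (m + 1) q) := by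
  obtain ⟨a, rfl⟩ := Submodule.Quotient.mk_surjective _ q
  rw [tQ_mk, delta_mk, delta_mk, map_sub, hEqv]

/-- `(lim A) → lim_N Q_m`, componentwise reduction. -/
def toLevelCoinv (hEqv : ∀ m a, t m (σ (m + 1) a) = σ m (t m a)) :
    invLim t →ₗ[R] invLim (A := fun m => LevelCoinv σ m) (tQ t σ hEqv) :=
  limMap (B := fun m => LevelCoinv σ m) t (tQ t σ hEqv) (fun m => (LinearMap.range (plus σ m)).mkQ)
    (fun m a => by rw [Submodule.mkQ_apply, Submodule.mkQ_apply, tQ_mk])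

/-- **`(lim A)/(1+σ)(lim A) ↠ lim_N Q_m`** from (N-ONTO): the kernel tower `(1+σ)A_m` has onto
transitions because `t_m` is onto and commutes with `σ`. -/
theorem toLevelCoinv_surjective (hEqv : ∀ m a, t m (σ (m + 1) a) = σ m (t m a))
    (hT : ∀ m, Function.Surjective (t m)) :
    Function.Surjective (toLevelCoinv t σ hEqv) := by
  refine limMap_surjective (B := fun m => LevelCoinv σ m) t (tQ t σ hEqv) _ _ ?_
    (fun m => Submodule.mkQ_surjective _)
  intro m c hc
  rw [Submodule.mkQ_apply, Submodule.Quotient.mk_eq_zero] at hc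
  obtain ⟨a, rfl⟩ := LinearMap.mem_range.1 hc
  obtain ⟨a', ha'⟩ := hT m a
  refine ⟨plus σ (m + 1) a', ?_, ?_⟩
  · rw [Submodule.mkQ_apply, Submodule.Quotient.mk_eq_zero]
    exact LinearMap.mem_range.2 ⟨a', rfl⟩
  · rw [← plus_comm t σ hEqv, ha']

/-- `δ_∞ : lim_N Q_m → Π m, A m`. -/
def limDelta (hσ2 : ∀ m a, σ m (σ m a) = a) (hEqv : ∀ m a, t m (σ (m + 1) a) = σ m (t m a)) :
    invLim (A := fun m => LevelCoinv σ m) (tQ t σ hEqv) →ₗ[R] (∀ m, A m) :=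
  (piMap (A := fun m => LevelCoinv σ m) (delta σ hσ2)).domRestrict _

@[simp] theorem limDelta_apply (hσ2 : ∀ m a, σ m (σ m a) = a)
    (hEqv : ∀ m a, t m (σ (m + 1) a) = σ m (t m a))
    (q : invLim (A := fun m => LevelCoinv σ m) (tQ t σ hEqv)) (m : ℕ) :
    limDelta t σ hσ2 hEqv q m = delta σ hσ2 m ((q : ∀ m, LevelCoinv σ m) m) := rfl

/-- `δ_∞ ∘ (reduction) = (1−σ)_∞`. -/
theorem limDelta_toLevelCoinv (hσ2 : ∀ m a, σ m (σ m a) = a)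
    (hEqv : ∀ m a, t m (σ (m + 1) a) = σ m (t m a)) (x : invLim t) :
    limDelta t σ hσ2 hEqv (toLevelCoinv t σ hEqv x) = limMinus t σ x := by
  funext m
  rw [limDelta_apply, limMinus_apply]
  exact delta_mk σ hσ2 m _

theorem range_limDelta_le (hσ2 : ∀ m a, σ m (σ m a) = a)
    (hEqv : ∀ m a, t m (σ (m + 1) a) = σ m (t m a)) :
    LinearMap.range (limDelta t σ hσ2 hEqv) ≤ limAnti t σ := by
  rintro _ ⟨q, rfl⟩
  refine ⟨fun m => ?_, fun m => ?_⟩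
  · show t m (limDelta t σ hσ2 hEqv q (m + 1)) = limDelta t σ hσ2 hEqv q m
    rw [limDelta_apply, limDelta_apply, ← delta_comm t σ hσ2 hEqv,
      coherent_of_mem (A := fun m => LevelCoinv σ m) q m]
  · rw [limDelta_apply]
    obtain ⟨a, ha⟩ := Submodule.Quotient.mk_surjective _ ((q : ∀ m, LevelCoinv σ m) m)
    rw [← ha, delta_mk]
    exact plus_minus σ hσ2 m a

/-- **`lim_N Q_m ↠ lim_N S_m`, NO class field theory**: the composite with the reduction is `(1−σ)_∞`,
which is onto `lim_N S_m` by §1 ((PROBE) + (F-ONTO)). -/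
theorem range_limDelta_eq (hσ2 : ∀ m a, σ m (σ m a) = a)
    (hEqv : ∀ m a, t m (σ (m + 1) a) = σ m (t m a))
    (hSD : ∀ m (a : A (m + 1)), plus σ (m + 1) a = 0 → ∃ b : A m, minus σ m b = t m a)
    (hF : ∀ m (c : A m), σ m c = c → ∃ c' : A (m + 1), σ (m + 1) c' = c' ∧ t m c' = c) :
    LinearMap.range (limDelta t σ hσ2 hEqv) = limAnti t σ := by
  refine le_antisymm (range_limDelta_le t σ hσ2 hEqv) ?_
  intro s hs
  obtain ⟨x, hx⟩ := LinearMap.mem_range.1 (limAnti_le_range_limMinus t σ hEqv hSD hF hs)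
  exact LinearMap.mem_range.2 ⟨toLevelCoinv t σ hEqv x, by rw [limDelta_toLevelCoinv, hx]⟩

/-- The kernel of `δ_∞` (`= lim_N Ĥ⁰(Δ, A_m)`) is killed by `2` — the located `e_χ`-artefact again. -/
theorem two_smul_ker_limDelta (hσ2 : ∀ m a, σ m (σ m a) = a)
    (hEqv : ∀ m a, t m (σ (m + 1) a) = σ m (t m a))
    (q : invLim (A := fun m => LevelCoinv σ m) (tQ t σ hEqv))
    (hq : q ∈ LinearMap.ker (limDelta t σ hσ2 hEqv)) : (2 : R) • q = 0 := by
  apply Subtype.ext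
  funext m
  show (2 : R) • (q : ∀ m, LevelCoinv σ m) m = 0
  have h0 : delta σ hσ2 m ((q : ∀ m, LevelCoinv σ m) m) = 0 := by
    have := congrFun (LinearMap.mem_ker.1 hq) m
    rwa [limDelta_apply] at this
  obtain ⟨a, ha⟩ := Submodule.Quotient.mk_surjective _ ((q : ∀ m, LevelCoinv σ m) m)
  rw [← ha] at h0 ⊢
  rw [delta_mk] at h0
  rw [← Submodule.Quotient.mk_smul, two_smul_eq_plus_of_fixed σ m (sub_eq_zero.1 h0).symm]
  exact (Submodule.Quotient.mk_eq_zero _).2 (LinearMap.mem_range.2 ⟨a, rfl⟩)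

/-- **Where B59 (iii)'s «×2» sits.**  The composite `eigen ↪ lim A ↠ coinvariants ↠ eigen` is
multiplication by `2`; the comparison `(1−σ)_∞` itself is ONTO (`range_coinvMap_eq`).  So the digit is
read through the comparison, never through the inclusion of the eigenspace into the quotient model. -/
theorem limMinus_of_mem_limAnti (x : invLim t) (hx : (x : ∀ m, A m) ∈ limAnti t σ) :
    limMinus t σ x = (2 : R) • (x : ∀ m, A m) := by
  funext m
  rw [limMinus_apply, Pi.smul_apply]
  have h : (x : ∀ m, A m) m + σ m ((x : ∀ m, A m) m) = 0 := hx.2 m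
  have hσ : σ m ((x : ∀ m, A m) m) = -((x : ∀ m, A m) m) :=
    eq_neg_iff_add_eq_zero.2 ((add_comm _ _).trans h)
  rw [hσ, sub_neg_eq_add, two_smul]

end Ladder

/-! ## §2 What the consumer reads is presentation-free -/

section Presentation

variable {R : Type u} [CommRing R]
variable {P M Y N B : Type*} [AddCommGroup P] [Module R P] [AddCommGroup M] [Module R M]
  [AddCommGroup Y] [Module R Y] [AddCommGroup N] [Module R N] [AddCommGroup B] [Module R B]

/-- k3-g32's level hypothesis `h : (range g).map ev = A'` does not see the presentation: for ANY
presentation `q : P ↠ M` the receptacle `P` with keyed log `g ∘ q` has the same `(range _).map ev`. -/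
theorem map_range_comp_of_surjective (g : M →ₗ[R] Y) (q : P →ₗ[R] M) (hq : Function.Surjective q)
    (ev : Y →ₗ[R] B) :
    (LinearMap.range (g.comp q)).map ev = (LinearMap.range g).map ev := by
  rw [LinearMap.range_comp_of_range_eq_top _ (LinearMap.range_eq_top.2 hq)]

/-- (S-T) is presentation-sensitive EXACTLY through the kernel of the presentation: if `g` is
injective on `M` then `ker (g ∘ q) = ker q` (zero for EIGEN / MINUS-QUOTIENT, the `2`-torsion of
§1 for COINVARIANT). -/
theorem ker_comp_of_injective (g : M →ₗ[R] Y) (hg : Function.Injective g) (q : P →ₗ[R] M) :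
    LinearMap.ker (g.comp q) = LinearMap.ker q :=
  LinearMap.ker_comp_of_ker_eq_bot _ (LinearMap.ker_eq_bot.2 hg)

/-- **Duals are presentation-free across an `r`-torsion kernel.**  If `q : P ↠ M` has kernel killed
by `r` and `N` has no `r`-torsion (`r = 2`, `N = Λ₂` a domain of characteristic `0`), then
precomposition `Hom_R(M, N) → Hom_R(P, N)` is a bijection. -/
theorem precomp_bijective_of_torsion_ker (q : P →ₗ[R] M) (hq : Function.Surjective q) (r : R)
    (hker : ∀ k ∈ LinearMap.ker q, r • k = 0) (hN : ∀ n : N, r • n = 0 → n = 0) :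
    Function.Bijective (fun φ : M →ₗ[R] N => φ.comp q) := by
  constructor
  · intro φ ψ h
    have h' : φ.comp q = ψ.comp q := h
    apply LinearMap.ext
    intro m
    obtain ⟨p, rfl⟩ := hq m
    exact LinearMap.congr_fun h' p
  · intro ψ
    have hψ : LinearMap.ker q ≤ LinearMap.ker ψ := by
      intro k hk
      rw [LinearMap.mem_ker]
      apply hN
      rw [← map_smul, hker k hk, map_zero]
    refine ⟨((LinearMap.ker q).liftQ ψ hψ).comp (q.quotKerEquivOfSurjective hq).symm.toLinearMap, ?_⟩
    apply LinearMap.ext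
    intro p
    show (LinearMap.ker q).liftQ ψ hψ ((q.quotKerEquivOfSurjective hq).symm (q p)) = ψ p
    have : (q.quotKerEquivOfSurjective hq).symm (q p) = Submodule.Quotient.mk p := by
      rw [LinearEquiv.symm_apply_eq, LinearMap.quotKerEquivOfSurjective_apply_mk]
    rw [this, Submodule.liftQ_apply]

/-- «`g` generates `Hom_R(M, N)`» iff «`g ∘ q` generates `Hom_R(P, N)`» — the dual-generator digit
of k3-g32 `frame_eq_two_unit_smul` is presentation-free across a `2`-torsion kernel. -/
theorem dual_cyclic_iff (q : P →ₗ[R] M) (hq : Function.Surjective q) (r : R)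
    (hker : ∀ k ∈ LinearMap.ker q, r • k = 0) (hN : ∀ n : N, r • n = 0 → n = 0)
    (g : M →ₗ[R] N) :
    (∀ φ : M →ₗ[R] N, ∃ a : R, φ = a • g) ↔ (∀ ψ : P →ₗ[R] N, ∃ a : R, ψ = a • g.comp q) := by
  constructor
  · intro h ψ
    obtain ⟨φ, hφ⟩ := (precomp_bijective_of_torsion_ker q hq r hker hN).2 ψ
    obtain ⟨a, rfl⟩ := h φ
    refine ⟨a, ?_⟩
    rw [← LinearMap.smul_comp]
    exact hφ.symm
  · intro h φ
    obtain ⟨a, ha⟩ := h (φ.comp q)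
    refine ⟨a, (precomp_bijective_of_torsion_ker q hq r hker hN).1 ?_⟩
    show φ.comp q = (a • g).comp q
    rw [ha, LinearMap.smul_comp]

/-- DICTIONARY with the tree's pinned datum: for `Υ` acting through `{1, σ}` and `χ(σ) = −1`, the
`χ`-relations `⟨υ·m − χ(υ)m⟩` of `SemilocalUnitData₂.coinvRel` (LTYZ §2.2 `M_χ`) are `range (σ + 1)` —
so `D.Coinv χ_u`, restricted to the `v`-component, IS the COINVARIANT presentation of §1. -/
theorem span_coinvRel_eq_range (s : M →ₗ[R] M) :
    Submodule.span R {y | ∃ m : M, y = s m - ((-1 : ℤ) • m)} = LinearMap.range (s + LinearMap.id) := by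
  refine le_antisymm (Submodule.span_le.2 ?_) ?_
  · rintro _ ⟨m, rfl⟩
    refine LinearMap.mem_range.2 ⟨m, ?_⟩
    rw [LinearMap.add_apply, LinearMap.id_apply, neg_one_zsmul, sub_neg_eq_add]
  · rintro _ ⟨m, rfl⟩
    refine Submodule.subset_span ⟨m, ?_⟩
    rw [LinearMap.add_apply, LinearMap.id_apply, neg_one_zsmul, sub_neg_eq_add]

/-- k1-g33's class-free digit predicate (row 101 / B59), restated locally for a functional `L : M → N`:
every scalar factorisation `L = r • h` has `r ∣ 2`. -/
def LowerDigit' (L : M →ₗ[R] N) : Prop := ∀ (r : R) (h : M →ₗ[R] N), L = r • h → r ∣ (2 : R)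

/-- **B59 (iii) answered for this comparison: the digit is KEPT.**  Reading the digit on ANY carrier `P`
through an onto comparison `q : P ↠ M` whose kernel is killed by `2` (the three quotient rungs of the
ladder) gives the same answer as on `M = lim_N S_m`, for `2`-torsion-free values `N` (`Λ_v` a domain). -/
theorem lowerDigit_comp_iff (q : P →ₗ[R] M) (hq : Function.Surjective q)
    (hker : ∀ k ∈ LinearMap.ker q, (2 : R) • k = 0) (hN : ∀ n : N, (2 : R) • n = 0 → n = 0)
    (L : M →ₗ[R] N) : LowerDigit' (L.comp q) ↔ LowerDigit' L := by
  constructor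
  · intro hd r h hL
    exact hd r (h.comp q) (by rw [hL, LinearMap.smul_comp])
  · intro hd r h' hL
    obtain ⟨h, rfl⟩ := (precomp_bijective_of_torsion_ker q hq 2 hker hN).2 h'
    refine hd r h ((precomp_bijective_of_torsion_ker q hq 2 hker hN).1 ?_)
    show L.comp q = (r • h).comp q
    rw [hL, LinearMap.smul_comp]

end Presentation

end Summit.BirchSwinnertonDyer.BirchSwinnertonDyer.Cruxes.SplitBadTwoLowerHalfOfFacts.ReceptacleLadderK3G35
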